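import Mathlib
import Literature.Probability.Divergences.KLDivConvexity
import HarnessLib

/-!
# Relative entropy of Gibbs tilts, the duality formula, and the transportation lemma (Boucheron–Lugosi–Massart §4.9–4.10)

Topic `Literature/Probability/Entropy`.  Everything PROVED (no named facts, no definitions), for Mathlib's
`InformationTheory.klDiv` and `MeasureTheory.Measure.tilted` (`μ^f = μ.tilted f`, the Gibbs reweighting
`dμ^f = e^f dμ / E_μ e^f`), on a probability space and for BOUNDED MEASURABLE test functions (the book states the results
for integrable / exponentially integrable ones — TODO(general form): BLM Cor. 4.14 and Lemma 4.18 for integrable `Z`):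

* `toReal_klDiv_tilted_left_eq` / `toReal_klDiv_tilted_right_eq` — `KL(μ^f ‖ μ) = E_{μ^f}[f] − log E_μ e^f` and
  `KL(μ ‖ μ^f) = log E_μ e^f − E_μ[f]`, both finite (Mathlib's `llr_tilted_left/right` integrated); whence the two-sided
  Gibbs–Jensen / Gibbs–Peierls–Bogoliubov bounds `E_μ[f] ≤ log E_μ e^f ≤ E_{μ^f}[f]`
  (`integral_le_log_integral_exp_of_abs_le`, `log_integral_exp_le_integral_tilted`). [folklore]
* `log_integral_exp_eq_integral_tilted_sub_klDiv`, `log_integral_exp_le_iff_forall_klDiv` — the **duality formula**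
  `log E_μ e^f = max_ν {E_ν[f] − KL(ν ‖ μ)}`, attained at `ν = μ^f`, in the usable form
  «`log E_μ e^f ≤ b ↔ ∀ ν` probability with `KL(ν ‖ μ) < ∞`, `E_ν[f] − KL(ν ‖ μ) ≤ b`» (the easy half is the Donsker–Varadhan
  inequality `Literature.Probability.Divergences.integral_le_toReal_klDiv_add_log`). [cite: BoucheronLugosiMassart2013, Cor. 4.14]
* the **transportation lemma** [cite: BoucheronLugosiMassart2013, Lemma 4.18]: if `log E_μ e^{λ(Z − E_μ Z)} ≤ φ(λ)` for
  `λ ∈ (0, b)` then every `ν` with `KL(ν ‖ μ) < ∞` has `E_ν Z − E_μ Z ≤ (φ(λ) + KL(ν ‖ μ))/λ`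
  (`integral_sub_integral_le_of_logmgf_le`); the sub-Gaussian case `φ(λ) = vλ²/2` (all `λ > 0`) gives
  `E_ν Z − E_μ Z ≤ √(2 v KL(ν ‖ μ))` (`integral_sub_integral_le_sqrt_of_subGaussian`, two-sided
  `abs_integral_sub_integral_le_sqrt_of_subGaussian`), and CONVERSELY the transport bound for all such `ν` gives back the
  sub-Gaussian bound (`logmgf_le_of_forall_integral_sub_le_sqrt`), i.e. the equivalence `subGaussian_iff_transport`.

Why here: this is the transfer device of the relative entropy method (an entropy budget `KL(ν ‖ μ) ≤ δ` moves the mean of a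
`μ`-sub-Gaussian observable by at most `√(2vδ)`), used by the hydrodynamic-limit routes (`EntropyInequality.lean`,
`DonskerVaradhanTransfer.lean`) and by the Yang–Mills entropy-budget line (`Summits/…/EntropyBudgetEquipartition*`, whose
Summits-side copies `…ScaleEntropy.toReal_klDiv_tilted_left/right` of the first bullet predate this file).
-/

noncomputable section

namespace Literature.Probability.Entropy

open _root_.MeasureTheory Filter InformationTheory

variable {Ω : Type*} [MeasurableSpace Ω] {μ : Measure Ω} [IsProbabilityMeasure μ] {f : Ω → ℝ} {B : ℝ}

/-! ### Relative entropy of a tilt -/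

/-- A bounded measurable real function has an integrable exponential under a probability measure. [folklore] -/
private theorem integrable_exp_of_measurable_of_abs_le (hf : Measurable f) (hB : ∀ ω, |f ω| ≤ B) :
    Integrable (fun ω => Real.exp (f ω)) μ := by
  refine Integrable.of_bound hf.exp.aestronglyMeasurable (Real.exp B) (ae_of_all _ fun ω => ?_)
  rw [Real.norm_eq_abs, abs_of_pos (Real.exp_pos _), Real.exp_le_exp]
  exact (le_abs_self _).trans (hB ω)

/-- A bounded measurable real function is integrable under every finite measure. [folklore] -/
private theorem integrable_of_measurable_of_abs_le {ν : Measure Ω} [IsFiniteMeasure ν] (hf : Measurable f)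
    (hB : ∀ ω, |f ω| ≤ B) : Integrable f ν :=
  Integrable.of_bound hf.aestronglyMeasurable B (ae_of_all _ fun ω => by rw [Real.norm_eq_abs]; exact hB ω)

/-- The log-likelihood ratio of the tilt `μ^f` against `μ` is `f − log E_μ e^f`, almost surely under the tilt. [folklore] -/
private theorem llr_tilted_left_self_ae (hf : Measurable f) (hB : ∀ ω, |f ω| ≤ B) :
    llr (μ.tilted f) μ =ᵐ[μ.tilted f] fun ω => f ω - Real.log (∫ z, Real.exp (f z) ∂μ) := by
  have h1 : llr (μ.tilted f) μ =ᵐ[μ] fun ω => f ω - Real.log (∫ z, Real.exp (f z) ∂μ) + llr μ μ ω :=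
    llr_tilted_left (Measure.AbsolutelyContinuous.rfl) (integrable_exp_of_measurable_of_abs_le hf hB) hf.aemeasurable
  have h2 : llr μ μ =ᵐ[μ] 0 := llr_self μ
  have h3 : llr (μ.tilted f) μ =ᵐ[μ] fun ω => f ω - Real.log (∫ z, Real.exp (f z) ∂μ) := by
    filter_upwards [h1, h2] with ω hω hω'
    rw [hω, hω', Pi.zero_apply, add_zero]
  exact (tilted_absolutelyContinuous μ f).ae_le h3

/-- The log-likelihood ratio of `μ` against its tilt `μ^f` is `log E_μ e^f − f`, almost surely under `μ`. [folklore] -/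
private theorem llr_self_tilted_right_ae (hf : Measurable f) (hB : ∀ ω, |f ω| ≤ B) :
    llr μ (μ.tilted f) =ᵐ[μ] fun ω => -f ω + Real.log (∫ z, Real.exp (f z) ∂μ) := by
  have h1 : llr μ (μ.tilted f) =ᵐ[μ] fun ω => -f ω + Real.log (∫ z, Real.exp (f z) ∂μ) + llr μ μ ω :=
    llr_tilted_right (Measure.AbsolutelyContinuous.rfl) (integrable_exp_of_measurable_of_abs_le hf hB)
  have h2 : llr μ μ =ᵐ[μ] 0 := llr_self μ
  filter_upwards [h1, h2] with ω hω hω'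
  rw [hω, hω', Pi.zero_apply, add_zero]

/-- **Relative entropy of a tilt, forward**: for bounded measurable `f`, `KL(μ^f ‖ μ)` is finite and equals
`E_{μ^f}[f] − log E_μ e^f` — the value of the Gibbs variational functional `P ↦ E_P f − D(P ‖ Q)` at its maximiser, the tilted
law `Q^f` («the unique maximizer … is `P = Q^f`»). [cite: PolyanskiyWu2024, Prop 4.7] -/
theorem toReal_klDiv_tilted_left_eq (hf : Measurable f) (hB : ∀ ω, |f ω| ≤ B) :
    klDiv (μ.tilted f) μ ≠ ⊤ ∧
      (klDiv (μ.tilted f) μ).toReal = (∫ ω, f ω ∂(μ.tilted f)) - Real.log (∫ ω, Real.exp (f ω) ∂μ) := by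
  haveI : IsProbabilityMeasure (μ.tilted f) :=
    isProbabilityMeasure_tilted (integrable_exp_of_measurable_of_abs_le hf hB)
  have hint : Integrable (fun ω => f ω - Real.log (∫ z, Real.exp (f z) ∂μ)) (μ.tilted f) :=
    (integrable_of_measurable_of_abs_le hf hB).sub (integrable_const _)
  have hllr : Integrable (llr (μ.tilted f) μ) (μ.tilted f) :=
    (integrable_congr (llr_tilted_left_self_ae hf hB)).2 hint
  refine ⟨klDiv_ne_top (tilted_absolutelyContinuous μ f) hllr, ?_⟩
  rw [toReal_klDiv_of_measure_eq (tilted_absolutelyContinuous μ f) (by simp),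
    integral_congr_ae (llr_tilted_left_self_ae hf hB),
    integral_sub (integrable_of_measurable_of_abs_le hf hB) (integrable_const _), integral_const, probReal_univ, one_smul]

/-- **Relative entropy of a tilt, backward**: for bounded measurable `f`, `KL(μ ‖ μ^f)` is finite and equals
`log E_μ e^f − E_μ[f]` (the same computation with the roles of the law and its tilt exchanged: `μ = (μ^f)^{−f}`).
[cite: PolyanskiyWu2024, Prop 4.7] -/
theorem toReal_klDiv_tilted_right_eq (hf : Measurable f) (hB : ∀ ω, |f ω| ≤ B) :
    klDiv μ (μ.tilted f) ≠ ⊤ ∧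
      (klDiv μ (μ.tilted f)).toReal = Real.log (∫ ω, Real.exp (f ω) ∂μ) - ∫ ω, f ω ∂μ := by
  haveI : IsProbabilityMeasure (μ.tilted f) :=
    isProbabilityMeasure_tilted (integrable_exp_of_measurable_of_abs_le hf hB)
  have hac : μ ≪ μ.tilted f := absolutelyContinuous_tilted (integrable_exp_of_measurable_of_abs_le hf hB)
  have hint : Integrable (fun ω => -f ω + Real.log (∫ z, Real.exp (f z) ∂μ)) μ :=
    (integrable_of_measurable_of_abs_le hf hB).neg.add (integrable_const _)
  have hllr : Integrable (llr μ (μ.tilted f)) μ := (integrable_congr (llr_self_tilted_right_ae hf hB)).2 hint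
  refine ⟨klDiv_ne_top hac hllr, ?_⟩
  rw [toReal_klDiv_of_measure_eq hac (by simp), integral_congr_ae (llr_self_tilted_right_ae hf hB)]
  have hfun : (fun ω => -f ω + Real.log (∫ z, Real.exp (f z) ∂μ)) =
      fun ω => Real.log (∫ z, Real.exp (f z) ∂μ) - f ω := funext fun ω => by ring
  rw [hfun, integral_sub (integrable_const _) (integrable_of_measurable_of_abs_le hf hB), integral_const, probReal_univ,
    one_smul]

/-- **Gibbs–Jensen**: `E_μ[f] ≤ log E_μ e^f` for bounded measurable `f` (`KL(μ ‖ μ^f) ≥ 0`; the duality formula tested at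
`Q = P`). [cite: BoucheronLugosiMassart2013, Cor. 4.14] -/
theorem integral_le_log_integral_exp_of_abs_le (hf : Measurable f) (hB : ∀ ω, |f ω| ≤ B) :
    ∫ ω, f ω ∂μ ≤ Real.log (∫ ω, Real.exp (f ω) ∂μ) := by
  have h := (toReal_klDiv_tilted_right_eq (μ := μ) hf hB).2
  have h0 : 0 ≤ (klDiv μ (μ.tilted f)).toReal := ENNReal.toReal_nonneg
  linarith

/-- **Gibbs–Peierls–Bogoliubov**: `log E_μ e^f ≤ E_{μ^f}[f]` for bounded measurable `f` (`KL(μ^f ‖ μ) ≥ 0`; the duality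
formula's supremum is attained at the tilt, where the entropy term is non-negative). [cite: BoucheronLugosiMassart2013, Cor. 4.14] -/
theorem log_integral_exp_le_integral_tilted (hf : Measurable f) (hB : ∀ ω, |f ω| ≤ B) :
    Real.log (∫ ω, Real.exp (f ω) ∂μ) ≤ ∫ ω, f ω ∂(μ.tilted f) := by
  have h := (toReal_klDiv_tilted_left_eq (μ := μ) hf hB).2
  have h0 : 0 ≤ (klDiv (μ.tilted f) μ).toReal := ENNReal.toReal_nonneg
  linarith

/-! ### The duality formula (Gibbs variational principle), attained at the tilt -/

/-- **Duality formula, attained**: `log E_μ e^f = E_{μ^f}[f] − KL(μ^f ‖ μ)` for bounded measurable `f`.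
[cite: BoucheronLugosiMassart2013, Cor. 4.14] -/
theorem log_integral_exp_eq_integral_tilted_sub_klDiv (hf : Measurable f) (hB : ∀ ω, |f ω| ≤ B) :
    Real.log (∫ ω, Real.exp (f ω) ∂μ) = (∫ ω, f ω ∂(μ.tilted f)) - (klDiv (μ.tilted f) μ).toReal := by
  have h := (toReal_klDiv_tilted_left_eq (μ := μ) hf hB).2
  linarith

/-- **Duality formula as a criterion**: for bounded measurable `f` and real `b`, `log E_μ e^f ≤ b` iff every probability measure
`ν` with `KL(ν ‖ μ) < ∞` satisfies `E_ν[f] − KL(ν ‖ μ) ≤ b` (Donsker–Varadhan for `→`; the tilt `ν = μ^f` for `←`).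
[cite: BoucheronLugosiMassart2013, Cor. 4.14] -/
theorem log_integral_exp_le_iff_forall_klDiv (hf : Measurable f) (hB : ∀ ω, |f ω| ≤ B) {b : ℝ} :
    Real.log (∫ ω, Real.exp (f ω) ∂μ) ≤ b ↔
      ∀ ν : Measure Ω, IsProbabilityMeasure ν → klDiv ν μ ≠ ⊤ → (∫ ω, f ω ∂ν) - (klDiv ν μ).toReal ≤ b := by
  constructor
  · intro h ν hν hfin
    haveI := hν
    have dv := Literature.Probability.Divergences.integral_le_toReal_klDiv_add_log (μ := ν) (ν := μ) hfin hf hB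
    linarith
  · intro h
    haveI : IsProbabilityMeasure (μ.tilted f) :=
      isProbabilityMeasure_tilted (integrable_exp_of_measurable_of_abs_le hf hB)
    rw [log_integral_exp_eq_integral_tilted_sub_klDiv hf hB]
    exact h _ inferInstance (toReal_klDiv_tilted_left_eq hf hB).1

/-! ### The transportation lemma -/

section Transport

variable {Z : Ω → ℝ}

omit [IsProbabilityMeasure μ] in
/-- The centred observable `Z − E_μ Z` is bounded (by `2B`) when `Z` is bounded by `B` under a probability measure. [folklore] -/
private theorem abs_sub_integral_le [IsProbabilityMeasure μ] (hB : ∀ ω, |Z ω| ≤ B) (ω : Ω) :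
    |Z ω - ∫ x, Z x ∂μ| ≤ 2 * B := by
  have h1 : |∫ x, Z x ∂μ| ≤ B := by
    have := norm_integral_le_of_norm_le_const (μ := μ) (f := Z) (C := B)
      (ae_of_all _ fun x => by rw [Real.norm_eq_abs]; exact hB x)
    rwa [probReal_univ, mul_one, Real.norm_eq_abs] at this
  calc |Z ω - ∫ x, Z x ∂μ| ≤ |Z ω| + |∫ x, Z x ∂μ| := abs_sub _ _
    _ ≤ B + B := add_le_add (hB ω) h1
    _ = 2 * B := by ring

/-- **Transportation lemma, one direction, general rate function** [cite: BoucheronLugosiMassart2013, Lemma 4.18]: if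
`log E_μ e^{λ(Z − E_μ Z)} ≤ φ(λ)` for some `λ > 0`, then every probability measure `ν` with `KL(ν ‖ μ) < ∞` has
`E_ν Z − E_μ Z ≤ (φ(λ) + KL(ν ‖ μ))/λ` (bounded measurable `Z`). -/
theorem integral_sub_integral_le_of_logmgf_le (hZ : Measurable Z) (hB : ∀ ω, |Z ω| ≤ B) {φl t : ℝ} (ht : 0 < t)
    (hmgf : Real.log (∫ ω, Real.exp (t * (Z ω - ∫ x, Z x ∂μ)) ∂μ) ≤ φl)
    {ν : Measure Ω} [IsProbabilityMeasure ν] (hfin : klDiv ν μ ≠ ⊤) :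
    (∫ ω, Z ω ∂ν) - (∫ ω, Z ω ∂μ) ≤ (φl + (klDiv ν μ).toReal) / t := by
  -- the bounded measurable test function `ψ = t (Z − E_μ Z)`
  have hψ : Measurable fun ω => t * (Z ω - ∫ x, Z x ∂μ) := (hZ.sub_const _).const_mul t
  have hψB : ∀ ω, |t * (Z ω - ∫ x, Z x ∂μ)| ≤ |t| * (2 * B) := fun ω => by
    rw [abs_mul]; exact mul_le_mul_of_nonneg_left (abs_sub_integral_le hB ω) (abs_nonneg _)
  have dv := Literature.Probability.Divergences.integral_le_toReal_klDiv_add_log (μ := ν) (ν := μ) hfin hψ hψB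
  -- `E_ν ψ = t (E_ν Z − E_μ Z)`
  have hZν : Integrable Z ν := integrable_of_measurable_of_abs_le hZ hB
  have hEψ : (∫ ω, t * (Z ω - ∫ x, Z x ∂μ) ∂ν) = t * ((∫ ω, Z ω ∂ν) - ∫ x, Z x ∂μ) := by
    rw [integral_const_mul, integral_sub hZν (integrable_const _), integral_const, probReal_univ, one_smul]
  rw [hEψ] at dv
  rw [le_div_iff₀ ht]
  linarith

/-- The optimisation behind the sub-Gaussian transport bound: if `a ≤ K/t + v t/2` for every `t > 0` (`v > 0`, `K ≥ 0`), then
`a ≤ √(2 v K)`. [folklore] -/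
private theorem le_sqrt_of_forall_le_div_add {a v K : ℝ} (hv : 0 < v) (hK : 0 ≤ K) (h : ∀ t : ℝ, 0 < t → a ≤ K / t + v * t / 2) :
    a ≤ Real.sqrt (2 * v * K) := by
  by_cases hK0 : K = 0
  · -- `a ≤ v t / 2` for all `t > 0` forces `a ≤ 0 = √0`
    subst hK0
    have h' : ∀ t : ℝ, 0 < t → a ≤ v * t / 2 := fun t ht => by simpa using h t ht
    rw [mul_zero, Real.sqrt_zero]
    by_contra ha
    push Not at ha
    have := h' (a / v) (div_pos ha hv)
    have e : v * (a / v) / 2 = a / 2 := by field_simp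
    linarith
  · have hKpos : 0 < K := lt_of_le_of_ne hK (Ne.symm hK0)
    set s : ℝ := Real.sqrt (2 * v * K) with hs
    have hs_pos : 0 < s := Real.sqrt_pos.2 (by positivity)
    have hs_sq : s * s = 2 * v * K := Real.mul_self_sqrt (by positivity)
    -- take `t = s / v`
    have ht : 0 < s / v := div_pos hs_pos hv
    have key := h (s / v) ht
    have e1 : K / (s / v) + v * (s / v) / 2 = s := by
      have hsv : s / v ≠ 0 := ht.ne'
      have hs0 : s ≠ 0 := hs_pos.ne'
      field_simp
      nlinarith [hs_sq]
    linarith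

/-- **Transportation lemma, sub-Gaussian case** [cite: BoucheronLugosiMassart2013, Lemma 4.18]: if
`log E_μ e^{λ(Z − E_μ Z)} ≤ v λ²/2` for every `λ > 0` (`v > 0`), then every probability measure `ν` with `KL(ν ‖ μ) < ∞` has
`E_ν Z − E_μ Z ≤ √(2 v KL(ν ‖ μ))` (bounded measurable `Z`). -/
theorem integral_sub_integral_le_sqrt_of_subGaussian (hZ : Measurable Z) (hB : ∀ ω, |Z ω| ≤ B) {v : ℝ} (hv : 0 < v)
    (hmgf : ∀ t : ℝ, 0 < t → Real.log (∫ ω, Real.exp (t * (Z ω - ∫ x, Z x ∂μ)) ∂μ) ≤ v * t ^ 2 / 2)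
    {ν : Measure Ω} [IsProbabilityMeasure ν] (hfin : klDiv ν μ ≠ ⊤) :
    (∫ ω, Z ω ∂ν) - (∫ ω, Z ω ∂μ) ≤ Real.sqrt (2 * v * (klDiv ν μ).toReal) := by
  refine le_sqrt_of_forall_le_div_add hv ENNReal.toReal_nonneg fun t ht => ?_
  have h := integral_sub_integral_le_of_logmgf_le hZ hB ht (hmgf t ht) hfin
  have e : (v * t ^ 2 / 2 + (klDiv ν μ).toReal) / t = (klDiv ν μ).toReal / t + v * t / 2 := by
    field_simp; ring
  linarith [e.le, e.ge]

/-- **Two-sided sub-Gaussian transport**: if both `Z` and `−Z` have the sub-Gaussian bound `v λ²/2` on their centred log-moment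
generating functions under `μ` (equivalently the bound holds for all real `λ`), then `|E_ν Z − E_μ Z| ≤ √(2 v KL(ν ‖ μ))`.
[cite: BoucheronLugosiMassart2013, Lemma 4.18] -/
theorem abs_integral_sub_integral_le_sqrt_of_subGaussian (hZ : Measurable Z) (hB : ∀ ω, |Z ω| ≤ B) {v : ℝ} (hv : 0 < v)
    (hmgf : ∀ t : ℝ, Real.log (∫ ω, Real.exp (t * (Z ω - ∫ x, Z x ∂μ)) ∂μ) ≤ v * t ^ 2 / 2)
    {ν : Measure Ω} [IsProbabilityMeasure ν] (hfin : klDiv ν μ ≠ ⊤) :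
    |(∫ ω, Z ω ∂ν) - (∫ ω, Z ω ∂μ)| ≤ Real.sqrt (2 * v * (klDiv ν μ).toReal) := by
  rw [abs_le]
  constructor
  · -- apply the one-sided bound to `−Z`
    have hZ' : Measurable fun ω => -Z ω := hZ.neg
    have hB' : ∀ ω, |-Z ω| ≤ B := fun ω => by rw [abs_neg]; exact hB ω
    have hmgf' : ∀ t : ℝ, 0 < t →
        Real.log (∫ ω, Real.exp (t * (-Z ω - ∫ x, -Z x ∂μ)) ∂μ) ≤ v * t ^ 2 / 2 := by
      intro t _
      have e : (fun ω => Real.exp (t * (-Z ω - ∫ x, -Z x ∂μ))) =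
          fun ω => Real.exp (-t * (Z ω - ∫ x, Z x ∂μ)) := by
        funext ω; rw [integral_neg]; ring_nf
      rw [e]
      simpa using hmgf (-t)
    have h := integral_sub_integral_le_sqrt_of_subGaussian hZ' hB' hv hmgf' hfin
    rw [integral_neg, integral_neg] at h
    linarith
  · exact integral_sub_integral_le_sqrt_of_subGaussian hZ hB hv (fun t _ => hmgf t) hfin

/-- **Transportation lemma, converse** [cite: BoucheronLugosiMassart2013, Lemma 4.18]: if every probability measure `ν` with
`KL(ν ‖ μ) < ∞` has `E_ν Z − E_μ Z ≤ √(2 v KL(ν ‖ μ))`, then `log E_μ e^{λ(Z − E_μ Z)} ≤ v λ²/2` for every `λ > 0`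
(duality formula at the tilt by `λ(Z − E_μ Z)`, and `λ√(2vK) ≤ vλ²/2 + K`). -/
theorem logmgf_le_of_forall_integral_sub_le_sqrt (hZ : Measurable Z) (hB : ∀ ω, |Z ω| ≤ B) {v : ℝ} (hv : 0 < v)
    (h : ∀ ν : Measure Ω, IsProbabilityMeasure ν → klDiv ν μ ≠ ⊤ →
      (∫ ω, Z ω ∂ν) - (∫ ω, Z ω ∂μ) ≤ Real.sqrt (2 * v * (klDiv ν μ).toReal))
    {t : ℝ} (ht : 0 < t) :
    Real.log (∫ ω, Real.exp (t * (Z ω - ∫ x, Z x ∂μ)) ∂μ) ≤ v * t ^ 2 / 2 := by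
  have hψ : Measurable fun ω => t * (Z ω - ∫ x, Z x ∂μ) := (hZ.sub_const _).const_mul t
  have hψB : ∀ ω, |t * (Z ω - ∫ x, Z x ∂μ)| ≤ |t| * (2 * B) := fun ω => by
    rw [abs_mul]; exact mul_le_mul_of_nonneg_left (abs_sub_integral_le hB ω) (abs_nonneg _)
  rw [log_integral_exp_le_iff_forall_klDiv hψ hψB]
  intro ν hν hfin
  haveI := hν
  set K : ℝ := (klDiv ν μ).toReal with hK
  have hK0 : 0 ≤ K := ENNReal.toReal_nonneg
  have hZν : Integrable Z ν := integrable_of_measurable_of_abs_le hZ hB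
  have hEψ : (∫ ω, t * (Z ω - ∫ x, Z x ∂μ) ∂ν) = t * ((∫ ω, Z ω ∂ν) - ∫ x, Z x ∂μ) := by
    rw [integral_const_mul, integral_sub hZν (integrable_const _), integral_const, probReal_univ, one_smul]
  rw [hEψ]
  have hd : (∫ ω, Z ω ∂ν) - (∫ x, Z x ∂μ) ≤ Real.sqrt (2 * v * K) := h ν hν hfin
  have hs_sq : Real.sqrt (2 * v * K) * Real.sqrt (2 * v * K) = 2 * v * K := Real.mul_self_sqrt (by positivity)
  -- `t √(2vK) ≤ v t²/2 + K` since `(v t − √(2vK))² ≥ 0`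
  have amgm : t * Real.sqrt (2 * v * K) ≤ v * t ^ 2 / 2 + K := by
    nlinarith [sq_nonneg (v * t - Real.sqrt (2 * v * K)), hs_sq, hv]
  nlinarith [mul_le_mul_of_nonneg_left hd ht.le, amgm]

/-- **Transportation lemma, sub-Gaussian equivalence** [cite: BoucheronLugosiMassart2013, Lemma 4.18]: for bounded measurable `Z`
and `v > 0`, `log E_μ e^{λ(Z − E_μ Z)} ≤ vλ²/2` for all `λ > 0` iff `E_ν Z − E_μ Z ≤ √(2 v KL(ν ‖ μ))` for every probability
measure `ν` with `KL(ν ‖ μ) < ∞`. -/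
theorem subGaussian_iff_transport (hZ : Measurable Z) (hB : ∀ ω, |Z ω| ≤ B) {v : ℝ} (hv : 0 < v) :
    (∀ t : ℝ, 0 < t → Real.log (∫ ω, Real.exp (t * (Z ω - ∫ x, Z x ∂μ)) ∂μ) ≤ v * t ^ 2 / 2) ↔
      ∀ ν : Measure Ω, IsProbabilityMeasure ν → klDiv ν μ ≠ ⊤ →
        (∫ ω, Z ω ∂ν) - (∫ ω, Z ω ∂μ) ≤ Real.sqrt (2 * v * (klDiv ν μ).toReal) :=
  ⟨fun h ν hν hfin => by haveI := hν; exact integral_sub_integral_le_sqrt_of_subGaussian hZ hB hv h hfin,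
    fun h _ ht => logmgf_le_of_forall_integral_sub_le_sqrt hZ hB hv h ht⟩

/-- **Transportation lemma, sub-gamma case** [cite: BoucheronLugosiMassart2013, Lemma 4.18]: if
`log E_μ e^{λ(Z − E_μ Z)} ≤ v λ²/(2(1 − cλ))` for every `0 < λ < 1/c` (`v, c > 0`; the sub-gamma bound on the right tail, for which
`φ*⁻¹(t) = √(2vt) + ct`), then every probability measure `ν` with `KL(ν ‖ μ) < ∞` has
`E_ν Z − E_μ Z ≤ √(2 v KL(ν ‖ μ)) + c KL(ν ‖ μ)` (bounded measurable `Z`; the general-rate direction at the explicit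
`λ = 1/(c + √(v/(2 KL)))`). -/
theorem integral_sub_integral_le_of_subGamma (hZ : Measurable Z) (hB : ∀ ω, |Z ω| ≤ B) {v c : ℝ} (hv : 0 < v) (hc : 0 < c)
    (hmgf : ∀ t : ℝ, 0 < t → t < 1 / c →
      Real.log (∫ ω, Real.exp (t * (Z ω - ∫ x, Z x ∂μ)) ∂μ) ≤ v * t ^ 2 / (2 * (1 - c * t)))
    {ν : Measure Ω} [IsProbabilityMeasure ν] (hfin : klDiv ν μ ≠ ⊤) :
    (∫ ω, Z ω ∂ν) - (∫ ω, Z ω ∂μ) ≤ Real.sqrt (2 * v * (klDiv ν μ).toReal) + c * (klDiv ν μ).toReal := by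
  set K : ℝ := (klDiv ν μ).toReal with hK
  have hK0 : 0 ≤ K := ENNReal.toReal_nonneg
  set a : ℝ := (∫ ω, Z ω ∂ν) - (∫ ω, Z ω ∂μ) with ha
  -- the general-rate bound at every admissible `t`
  have hgen : ∀ t : ℝ, 0 < t → t < 1 / c → a ≤ (v * t ^ 2 / (2 * (1 - c * t)) + K) / t := fun t ht ht' =>
    integral_sub_integral_le_of_logmgf_le hZ hB ht (hmgf t ht ht') hfin
  by_cases hKz : K = 0
  · -- no entropy: `a ≤ v t/(2(1−ct)) ≤ v t` for small `t`, hence `a ≤ 0`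
    rw [hKz, mul_zero, Real.sqrt_zero, mul_zero, add_zero]
    by_contra hapos
    push Not at hapos
    set t : ℝ := min (1 / (2 * c)) (a / (2 * v)) with ht
    have ht0 : 0 < t := lt_min (by positivity) (by positivity)
    have ht1 : t ≤ 1 / (2 * c) := min_le_left _ _
    have ht2 : t ≤ a / (2 * v) := min_le_right _ _
    have hct : c * t ≤ 1 / 2 := by
      have := mul_le_mul_of_nonneg_left ht1 hc.le
      rwa [mul_one_div, show c / (2 * c) = 1 / 2 by field_simp] at this
    have ht' : t < 1 / c := by
      rw [lt_div_iff₀ hc]; nlinarith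
    have h1 := hgen t ht0 ht'
    rw [hKz, add_zero] at h1
    -- `(v t² / (2(1 − ct))) / t = v t / (2 (1 − ct)) ≤ v t ≤ a / 2`
    have hden : 0 < 2 * (1 - c * t) := by nlinarith
    have e : v * t ^ 2 / (2 * (1 - c * t)) / t = v * t / (2 * (1 - c * t)) := by
      field_simp
    rw [e] at h1
    have h2 : v * t / (2 * (1 - c * t)) ≤ v * t := by
      rw [div_le_iff₀ hden]; nlinarith [mul_pos hv ht0]
    have h3 : v * t ≤ a / 2 := by
      have := mul_le_mul_of_nonneg_left ht2 hv.le
      rwa [show v * (a / (2 * v)) = a / 2 by field_simp] at this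
    linarith
  · have hKpos : 0 < K := lt_of_le_of_ne hK0 (Ne.symm hKz)
    -- `s = √(v/(2K))`, `t = 1/(c + s)`
    set s : ℝ := Real.sqrt (v / (2 * K)) with hs
    have hs_pos : 0 < s := Real.sqrt_pos.2 (by positivity)
    have hs_sq : s * s = v / (2 * K) := Real.mul_self_sqrt (by positivity)
    have hcs : 0 < c + s := by positivity
    set t : ℝ := 1 / (c + s) with ht
    have ht0 : 0 < t := by positivity
    have ht' : t < 1 / c := by
      rw [ht]; exact one_div_lt_one_div_of_lt hc (by linarith)
    have h1 := hgen t ht0 ht'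
    -- evaluate the bound at `t`: it is `s K + c K + s K`
    have hv2 : s * s * (2 * K) = v := by rw [hs_sq]; field_simp
    have hct : 1 - c * t = s / (c + s) := by rw [ht]; field_simp; ring
    have e1 : (v * t ^ 2 / (2 * (1 - c * t)) + K) / t = v / (2 * s) + K * (c + s) := by
      rw [hct, ht]
      field_simp
    have e2 : v / (2 * s) = s * K := by
      rw [div_eq_iff (by positivity)]
      linear_combination (-1 : ℝ) * hv2
    have e3' : 2 * s * K * (2 * s * K) = 2 * v * K := by linear_combination (2 * K) * hv2
    have e3 : Real.sqrt (2 * v * K) = 2 * s * K := by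
      rw [Real.sqrt_eq_iff_mul_self_eq (by positivity) (by positivity)]
      first | exact e3' | exact e3'.symm
    rw [e1, e2] at h1
    rw [e3]
    linarith

end Transport

end Literature.Probability.Entropy

end
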